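import Summits.FinalStateConjecture.FinalStateConjecture.Theorems.EIHFluxBalanceInertialRecessionStubWeightedRatesNecessityQS
import Summits.FinalStateConjecture.FinalStateConjecture.Theorems.WeightedQuasiStationarity.Negative.KinematicShadowJetRatesCalculus
import Summits.FinalStateConjecture.FinalStateConjecture.Theorems.WeightedQuasiStationarity.Negative.KinematicShadowJetRatesBoost

/-!
# Route EIHFluxBalance — item `WeightedQuasiStationarity` (stmt-FinalStateConjecture-16928):
# the kinematic shadow stays false under WEIGHTED JET RATES of orders 2 and 3

Negative-lane file of the prover seated on the route item `WeightedQuasiStationarity`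
(stmt-FinalStateConjecture-16928), `--supports stmt-FinalStateConjecture-16928`; strengthening of
`…Negative.KinematicShadow.not_weightedQuasiStationarity_kinematicShadow`. No Theses decl is asserted.

Pointwise, the weighted Ricci-flatness of the modulated ansatz on cone slabs sees the painted boost
RATE only through the kernel `M/d²` (one power of `d` short of the weight `d^{7/4}`), so the clauses one
can hope to get cheaply at the top scale are the WEIGHTED SECOND and THIRD order rates
`t^{3/4}‖(Λᵢe₀)¨‖ → 0`, `t^{3/4}‖(Λᵢe₀)⃛‖ → 0`. This file shows that adding exactly these two clauses to
the kinematic shadow of the item does not rescue it (the first-order weighted rate IS expected from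
the field equations for isolated holes — by the shell-INTEGRATED momentum constraint, whose
Landau–Lifshitz sphere momentum of the modulated ansatz carries `−(1/3)MRu̇` at leading order; see the
item's evidence note v2 — but that is field-equation content, consistent with this file):

* `not_weightedQuasiStationarity_jetRateShadow` — the item with every development clause deleted,
  the kinematic clauses, `0 < N`, the slaving block and QS kept VERBATIM, and the extra hypothesis
  `∀ i, ∀ m ∈ {2, 3}, t^{3/4}‖(Λᵢe₀)^{(m)}(t)‖ → 0`, is FALSE. Witness: one Schwarzschild hole painted
  with the pure boost of lab velocity `w = ε (1+t²)^{-1/8} sin((1+t²)^{1/4}) • e₁` (`ε = 1/4`,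
  `ξ ≡ 0`): `u̇ ≍ t^{-3/4} cos ψ` fails the weighted first-order rate (so QS fails by
  `weightedRate_e0_of_QS_one`), while `u^{(k)} = O((1+t²)^{-1/8-k/4})` makes `w, ẇ, ẅ, w⃛ → 0`
  (slaving) and, through the pointwise Faà di Bruno bound with `D(t) = K(1+t²)^{-7/24}`,
  `t^{3/4}‖(Λe₀)^{(m)}‖ ≲ (1+t²)^{3/8 - 7m/24} → 0` for `m = 2, 3`.

So the missing input of the item is FIRST order and weighted — RATES_E0 / QS itself (equivalently,
given the second-order rate, the weighted CONVERGENCE of the painted 4-velocities, file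
`…EIHFluxBalanceWeightedQuasiStationarityWeightedConvergence`) — and it has to come from the field
equations (for clear scales: the shell identity; for tight sub-clusters: open).
-/

set_option linter.dupNamespace false

noncomputable section

namespace Summit.FinalStateConjecture.FinalStateConjecture.Theorems.WeightedQuasiStationarity.Negative

open scoped Topology ENNReal
open Filter Set Function Metric Asymptotics Literature.Geometry.Lorentzian
open Summit.FinalStateConjecture.FinalStateConjecture.Theorems
open Summit.FinalStateConjecture.FinalStateConjecture.Theorems.SublinearIsFree.WeightedRates

/-- From an order `X = O((1+t²)^e)` an eventual bound with a positive constant. [folklore] -/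
theorem eventually_le_of_isBigO_rpow {X : ℝ → ℝ} {e : ℝ}
    (hX : X =O[atTop] (fun t : ℝ ↦ (1 + t ^ 2) ^ e)) :
    ∃ c : ℝ, 0 < c ∧ ∀ᶠ t in atTop, |X t| ≤ c * (1 + t ^ 2) ^ e := by
  obtain ⟨c, hc, h⟩ := hX.exists_pos
  refine ⟨c, hc, h.bound.mono fun t ht ↦ ?_⟩
  rwa [Real.norm_eq_abs, Real.norm_eq_abs, abs_of_nonneg (Real.rpow_nonneg (by positivity) _)] at ht

-- operator-norm instance paths on form-valued maps are slow to unify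
set_option synthInstance.maxHeartbeats 200000 in
set_option maxHeartbeats 3200000 in
/-- **The kinematic shadow of `WeightedQuasiStationarity` stays false under weighted jet rates of
orders 2 and 3.** See the module docstring: the statement is the item with its development clauses
deleted plus the hypothesis `∀ i, ∀ m ∈ {2,3}, t^{3/4}‖(Λᵢe₀)^{(m)}‖ → 0`; the witness is one
Schwarzschild hole (`N = 1`, `M = 1`, `a = 0`, `rin = 1`, `γ = 2`, `κ = 1/2`, `ξ ≡ 0`) painted with
`Λ(t) = boost(w(t))`, `w(t) = ((1/4)(1+t²)^{-1/8} sin((1+t²)^{1/4})) • e₁`. [folklore] -/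
theorem not_weightedQuasiStationarity_jetRateShadow :
    ¬ (open Literature.Geometry.Lorentzian in ∀ (N : ℕ) (M a rin : Fin N → ℝ)
      (Λ : Fin N → ℝ → lorentzGroup) (ξ : Fin N → ℝ → E3) (γ κ : ℝ),
      ((∀ i, Kerr.IsSubextremal (M i) (a i) ∧ Kerr.rMinus (M i) (a i) < rin i ∧
          rin i < Kerr.rPlus (M i) (a i)) ∧
        (∀ i t, |((Λ i t : E4 ≃L[ℝ] E4) (E4.basisVector 0)) 0| ≤ γ) ∧
        (∀ i, ContDiff ℝ ((⊤ : ℕ∞) : WithTop ℕ∞) (ξ i) ∧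
          ContDiff ℝ ((⊤ : ℕ∞) : WithTop ℕ∞) (fun t ↦ ((Λ i t : E4 ≃L[ℝ] E4) : E4 →L[ℝ] E4))) ∧
        (∀ i j, i ≠ j → Tendsto (fun t ↦ ‖ξ i t - ξ j t‖) atTop atTop) ∧
        (0 < κ ∧ κ < 1 ∧ ∀ i, ∀ᶠ t in atTop, ‖ξ i t‖ ≤ κ ^ 2 * t)) →
      0 < N →
      (∀ i : Fin N, (∀ m : ℕ, 1 ≤ m → m ≤ 3 → Tendsto (fun t ↦ iteratedDeriv m
          (fun s ↦ (((Λ i s : lorentzGroup) : E4 ≃L[ℝ] E4) (E4.basisVector 0))) t) atTop (𝓝 0)) ∧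
        (∀ m : ℕ, m ≤ 2 → Tendsto (fun t ↦ iteratedDeriv m (fun s ↦ deriv (ξ i) s -
          (((((Λ i s : lorentzGroup) : E4 ≃L[ℝ] E4) (E4.basisVector 0)) 0)⁻¹ •
            E4.spatial (((Λ i s : lorentzGroup) : E4 ≃L[ℝ] E4) (E4.basisVector 0)))) t)
              atTop (𝓝 0)) ∧
        (a i ≠ 0 → ∀ m : ℕ, 1 ≤ m → m ≤ 3 → Tendsto (fun t ↦ iteratedDeriv m
          (fun s ↦ (((Λ i s : lorentzGroup) : E4 ≃L[ℝ] E4) (E4.basisVector 3))) t) atTop (𝓝 0))) →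
      (∀ i : Fin N, ∀ m : ℕ, 2 ≤ m → m ≤ 3 → Tendsto (fun t : ℝ ↦ t ^ (3 / 4 : ℝ) *
          ‖iteratedDeriv m (fun s ↦ (((Λ i s : lorentzGroup) : E4 ≃L[ℝ] E4) (E4.basisVector 0))) t‖)
            atTop (𝓝 0)) →
      (∀ ρ : ℝ → ℝ, Tendsto ρ atTop atTop → Tendsto (fun t : ℝ ↦ ⨆ x ∈ {x : E4 | x 0 = t ∧
          E4.spatialNorm x ≤ κ * t ∧ ρ t ≤ ⨅ i, ‖E4.spatial x - ξ i t‖},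
        ENNReal.ofReal (1 + √(√((⨅ i, ‖E4.spatial x - ξ i t‖) ^ 7))) *
          ‖fderiv ℝ (fun y : E4 ↦ Minkowski.bilin + ∑ i, (boostedKerrBilin (Λ i (y 0))
            (E4.ofTimeSpace (y 0) (ξ i (y 0))) (M i) (a i) y - Minkowski.bilin)) x
              (E4.basisVector 0)‖ₑ) atTop (𝓝 0)))  := by
  intro H
  -- amplitude `A = (1+t²)^{-1/8}` and phase `ψ = (1+t²)^{1/4}` with three derivatives each
  set A0 : ℝ → ℝ := fun s ↦ (1 + s ^ 2) ^ (-(1 / 8) : ℝ) with hA0def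
  set A1 : ℝ → ℝ := fun t ↦ 2 * t * (-(1 / 8) : ℝ) * (1 + t ^ 2) ^ ((-(1 / 8) : ℝ) - 1) with hA1def
  set A2 : ℝ → ℝ := fun t ↦ 2 * (-(1 / 8) : ℝ) * (1 + t ^ 2) ^ ((-(1 / 8) : ℝ) - 1) +
    4 * (-(1 / 8) : ℝ) * ((-(1 / 8) : ℝ) - 1) * t ^ 2 * (1 + t ^ 2) ^ ((-(1 / 8) : ℝ) - 2) with hA2def
  set A3 : ℝ → ℝ := fun t ↦ 12 * (-(1 / 8) : ℝ) * ((-(1 / 8) : ℝ) - 1) * t *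
      (1 + t ^ 2) ^ ((-(1 / 8) : ℝ) - 2) +
    8 * (-(1 / 8) : ℝ) * ((-(1 / 8) : ℝ) - 1) * ((-(1 / 8) : ℝ) - 2) * t ^ 3 *
      (1 + t ^ 2) ^ ((-(1 / 8) : ℝ) - 3) with hA3def
  set ψ0 : ℝ → ℝ := fun s ↦ (1 + s ^ 2) ^ (1 / 4 : ℝ) with hψ0def
  set ψ1 : ℝ → ℝ := fun t ↦ 2 * t * (1 / 4 : ℝ) * (1 + t ^ 2) ^ ((1 / 4 : ℝ) - 1) with hψ1def
  set ψ2 : ℝ → ℝ := fun t ↦ 2 * (1 / 4 : ℝ) * (1 + t ^ 2) ^ ((1 / 4 : ℝ) - 1) +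
    4 * (1 / 4 : ℝ) * ((1 / 4 : ℝ) - 1) * t ^ 2 * (1 + t ^ 2) ^ ((1 / 4 : ℝ) - 2) with hψ2def
  set ψ3 : ℝ → ℝ := fun t ↦ 12 * (1 / 4 : ℝ) * ((1 / 4 : ℝ) - 1) * t * (1 + t ^ 2) ^ ((1 / 4 : ℝ) - 2) +
    8 * (1 / 4 : ℝ) * ((1 / 4 : ℝ) - 1) * ((1 / 4 : ℝ) - 2) * t ^ 3 *
      (1 + t ^ 2) ^ ((1 / 4 : ℝ) - 3) with hψ3def
  have hA : ∀ t, HasDerivAt A0 (A1 t) t := fun t ↦ hasDerivAt_ampl0 _ t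
  have hA1 : ∀ t, HasDerivAt A1 (A2 t) t := fun t ↦ hasDerivAt_ampl1 _ t
  have hA2 : ∀ t, HasDerivAt A2 (A3 t) t := fun t ↦ hasDerivAt_ampl2 _ t
  have hψ : ∀ t, HasDerivAt ψ0 (ψ1 t) t := fun t ↦ hasDerivAt_ampl0 _ t
  have hψ1 : ∀ t, HasDerivAt ψ1 (ψ2 t) t := fun t ↦ hasDerivAt_ampl1 _ t
  have hψ2 : ∀ t, HasDerivAt ψ2 (ψ3 t) t := fun t ↦ hasDerivAt_ampl2 _ t
  have hS0 : ∀ t, HasDerivAt (fun s ↦ Real.sin (ψ0 s)) (Real.cos (ψ0 t) * ψ1 t) t :=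
    hasDerivAt_sinComp0 hψ
  have hS1 := hasDerivAt_sinComp1 hψ hψ1
  have hS2 := hasDerivAt_sinComp2 hψ hψ1 hψ2
  have hApos : ∀ t, 0 < A0 t := fun t ↦ Real.rpow_pos_of_pos (by positivity) _
  have hAle : ∀ t, A0 t ≤ 1 := fun t ↦
    Real.rpow_le_one_of_one_le_of_nonpos (one_le_one_add_sq t) (by norm_num)
  have hAsmooth : ContDiff ℝ ((⊤ : ℕ∞) : WithTop ℕ∞) A0 := by
    rw [contDiff_iff_contDiffAt]
    intro t
    exact (contDiffAt_const.add (contDiffAt_id.pow 2)).rpow_const_of_ne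
      (by positivity : (0 : ℝ) < 1 + t ^ 2).ne'
  have hψsmooth : ContDiff ℝ ((⊤ : ℕ∞) : WithTop ℕ∞) ψ0 := by
    rw [contDiff_iff_contDiffAt]
    intro t
    exact (contDiffAt_const.add (contDiffAt_id.pow 2)).rpow_const_of_ne
      (by positivity : (0 : ℝ) < 1 + t ^ 2).ne'
  -- the speed `u = ε A sin ψ`, the axis `e`, the velocity `w = u • e`
  set ε : ℝ := 1 / 4 with hε
  set e : E3 := EuclideanSpace.single 0 1 with hedef
  have he : ‖e‖ = 1 := by rw [hedef]; simp
  set u : ℝ → ℝ := fun s ↦ ε * (A0 s * Real.sin (ψ0 s)) with hudef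
  set w : ℝ → E3 := fun s ↦ u s • e with hwdef
  have hub : ∀ t, |u t| ≤ 1 / 4 := fun t ↦ by
    rw [hudef]
    dsimp only
    rw [abs_mul, abs_mul, abs_of_pos (hApos t), hε, abs_of_pos (by norm_num : (0 : ℝ) < 1 / 4)]
    have := Real.abs_sin_le_one (ψ0 t)
    nlinarith [hAle t, hApos t, abs_nonneg (Real.sin (ψ0 t))]
  have hwn : ∀ t, ‖w t‖ = |u t| := fun t ↦ by
    rw [hwdef]; dsimp only; rw [norm_smul, he, mul_one, Real.norm_eq_abs]
  have hwb : ∀ t, ‖w t‖ ≤ 1 / 4 := fun t ↦ (hwn t).le.trans (hub t)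
  have hw1 : ∀ t, ‖w t‖ < 1 := fun t ↦ norm_lt_one_of_le_quarter (hwb t)
  have husmooth : ContDiff ℝ ((⊤ : ℕ∞) : WithTop ℕ∞) u :=
    contDiff_const.mul (hAsmooth.mul (Real.contDiff_sin.comp hψsmooth))
  have hwsmooth : ContDiff ℝ ((⊤ : ℕ∞) : WithTop ℕ∞) w := husmooth.smul contDiff_const
  -- closed forms and orders of the derivatives of `w`
  obtain ⟨e1, e2, e3⟩ := iteratedDeriv_w_prod hA hA1 hA2 hS0 hS1 hS2 ε e
  obtain ⟨c0, c1, c2, c3, q1, q2, q3⟩ := isBigO_witness2_concrete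
  obtain ⟨o0, o1, o2, o3⟩ := isBigO_witness2 (A0 := A0) (A1 := A1) (A2 := A2) (A3 := A3)
    (ψ0 := ψ0) (ψ1 := ψ1) (ψ2 := ψ2) (ψ3 := ψ3) ε c0 c1 c2 c3 q1 q2 q3
  -- the derivatives of `w` tend to `0`
  have key : ∀ {g : ℝ → ℝ}, Tendsto g atTop (𝓝 0) → Tendsto (fun t ↦ g t • e) atTop (𝓝 0) := by
    intro g hg
    simpa using hg.smul_const e
  have hwlim : ∀ m ≤ 3, Tendsto (fun t ↦ iteratedDeriv m w t) atTop (𝓝 0) := by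
    intro m hm
    interval_cases m
    · simpa [iteratedDeriv_zero] using key (tendsto_zero_of_isBigO_rpow (by norm_num) o0)
    · change Tendsto (fun t ↦ iteratedDeriv 1 (fun s ↦ (ε * (A0 s * Real.sin (ψ0 s))) • e) t)
        atTop (𝓝 0)
      rw [e1]; exact key (tendsto_zero_of_isBigO_rpow (by norm_num) o1)
    · change Tendsto (fun t ↦ iteratedDeriv 2 (fun s ↦ (ε * (A0 s * Real.sin (ψ0 s))) • e) t)
        atTop (𝓝 0)
      rw [e2]; exact key (tendsto_zero_of_isBigO_rpow (by norm_num) o2)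
    · change Tendsto (fun t ↦ iteratedDeriv 3 (fun s ↦ (ε * (A0 s * Real.sin (ψ0 s))) • e) t)
        atTop (𝓝 0)
      rw [e3]; exact key (tendsto_zero_of_isBigO_rpow (by norm_num) o3)
  -- eventual pointwise bounds on the derivatives of `w`
  obtain ⟨k1, hk1, b1⟩ := eventually_le_of_isBigO_rpow o1
  obtain ⟨k2, hk2, b2⟩ := eventually_le_of_isBigO_rpow o2
  obtain ⟨k3, hk3, b3⟩ := eventually_le_of_isBigO_rpow o3
  set K : ℝ := max (max k1 k2) (max k3 1) with hKdef
  have hK1 : 1 ≤ K := le_max_of_le_right (le_max_right _ _)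
  have hKk1 : k1 ≤ K := le_max_of_le_left (le_max_left _ _)
  have hKk2 : k2 ≤ K := le_max_of_le_left (le_max_right _ _)
  have hKk3 : k3 ≤ K := le_max_of_le_right (le_max_left _ _)
  have hK0 : 0 ≤ K := zero_le_one.trans hK1
  have hnorm1 : ∀ t, ‖iteratedDeriv 1 w t‖ =
      |ε * (A1 t * Real.sin (ψ0 t) + A0 t * (Real.cos (ψ0 t) * ψ1 t))| := fun t ↦ by
    change ‖iteratedDeriv 1 (fun s ↦ (ε * (A0 s * Real.sin (ψ0 s))) • e) t‖ = _
    rw [e1]; dsimp only; rw [norm_smul, he, mul_one, Real.norm_eq_abs]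
  have hnorm2 : ∀ t, ‖iteratedDeriv 2 w t‖ =
      |ε * (A2 t * Real.sin (ψ0 t) + 2 * A1 t * (Real.cos (ψ0 t) * ψ1 t) +
        A0 t * (-(Real.sin (ψ0 t) * ψ1 t ^ 2) + Real.cos (ψ0 t) * ψ2 t))| := fun t ↦ by
    change ‖iteratedDeriv 2 (fun s ↦ (ε * (A0 s * Real.sin (ψ0 s))) • e) t‖ = _
    rw [e2]; dsimp only; rw [norm_smul, he, mul_one, Real.norm_eq_abs]
  have hnorm3 : ∀ t, ‖iteratedDeriv 3 w t‖ =
      |ε * (A3 t * Real.sin (ψ0 t) + 3 * A2 t * (Real.cos (ψ0 t) * ψ1 t) +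
        3 * A1 t * (-(Real.sin (ψ0 t) * ψ1 t ^ 2) + Real.cos (ψ0 t) * ψ2 t) +
        A0 t * (-(Real.cos (ψ0 t) * ψ1 t ^ 3) - 3 * Real.sin (ψ0 t) * ψ1 t * ψ2 t +
          Real.cos (ψ0 t) * ψ3 t))| := fun t ↦ by
    change ‖iteratedDeriv 3 (fun s ↦ (ε * (A0 s * Real.sin (ψ0 s))) • e) t‖ = _
    rw [e3]; dsimp only; rw [norm_smul, he, mul_one, Real.norm_eq_abs]
  have hdom : ∀ᶠ t in atTop, ∀ i, 1 ≤ i → i ≤ 3 →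
      ‖iteratedDeriv i w t‖ ≤ (K * (1 + t ^ 2) ^ (-(7 / 24) : ℝ)) ^ i := by
    filter_upwards [b1, b2, b3] with t ht1 ht2 ht3
    have hf1 : (1 : ℝ) ≤ 1 + t ^ 2 := one_le_one_add_sq t
    have hf0 : (0 : ℝ) < 1 + t ^ 2 := by positivity
    have hfq : ∀ q : ℝ, 0 ≤ (1 + t ^ 2) ^ q := fun q ↦ Real.rpow_nonneg hf0.le _
    have hpow : ∀ (i : ℕ), (K * (1 + t ^ 2) ^ (-(7 / 24) : ℝ)) ^ i =
        K ^ i * (1 + t ^ 2) ^ ((-(7 / 24) : ℝ) * i) := fun i ↦ by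
      rw [mul_pow, Real.rpow_mul_natCast hf0.le]
    intro i hi1 hi3
    rw [hpow]
    interval_cases i
    · rw [hnorm1, pow_one]
      refine ht1.trans ?_
      have hmono : (1 + t ^ 2) ^ (-(3 / 8) : ℝ) ≤ (1 + t ^ 2) ^ ((-(7 / 24) : ℝ) * (1 : ℕ)) := by
        norm_num
        exact Real.rpow_le_rpow_of_exponent_le hf1 (by norm_num)
      exact mul_le_mul hKk1 hmono (hfq _) hK0
    · rw [hnorm2]
      refine ht2.trans ?_
      have hmono : (1 + t ^ 2) ^ (-(5 / 8) : ℝ) ≤ (1 + t ^ 2) ^ ((-(7 / 24) : ℝ) * (2 : ℕ)) := by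
        norm_num
        exact Real.rpow_le_rpow_of_exponent_le hf1 (by norm_num)
      have hK2 : k2 ≤ K ^ 2 := hKk2.trans (le_self_pow₀ hK1 (by norm_num))
      exact mul_le_mul hK2 hmono (hfq _) (by positivity)
    · rw [hnorm3]
      refine ht3.trans ?_
      have hmono : (1 + t ^ 2) ^ (-(7 / 8) : ℝ) ≤ (1 + t ^ 2) ^ ((-(7 / 24) : ℝ) * (3 : ℕ)) := by
        norm_num
      have hK3 : k3 ≤ K ^ 3 := hKk3.trans (le_self_pow₀ hK1 (by norm_num))
      exact mul_le_mul hK3 hmono (hfq _) (by positivity)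
  -- the painted frame
  set Λ : ℝ → lorentzGroup := fun t ↦ Lorentz.boost (w t) (hw1 t) with hΛdef
  have hcoe : (fun t ↦ ((Λ t : E4 ≃L[ℝ] E4) : E4 →L[ℝ] E4)) = fun t ↦ Lorentz.boostCLM (w t) := rfl
  have hΛsmooth : ContDiff ℝ ((⊤ : ℕ∞) : WithTop ℕ∞) (fun t ↦ ((Λ t : E4 ≃L[ℝ] E4) : E4 →L[ℝ] E4)) := by
    rw [hcoe]; exact contDiff_boostCLM_comp hwsmooth hw1
  have hγ : ∀ t, |((Λ t : E4 ≃L[ℝ] E4) (E4.basisVector 0)) 0| ≤ 2 := fun t ↦ by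
    change |((Lorentz.boost (w t) (hw1 t) : E4 ≃L[ℝ] E4) (E4.basisVector 0)) 0| ≤ 2
    rw [Lorentz.boost_apply_basisVector_zero_zero, abs_of_pos (Lorentz.gamma_pos (hw1 t))]
    exact gamma_le_two (hwb t)
  -- the Faà di Bruno constant of `v ↦ boostCLM v e₀` along `w`
  obtain ⟨C, hC0, hC⟩ := exists_norm_iteratedDeriv_comp_le
    (F := fun v ↦ Lorentz.boostCLM v (E4.basisVector 0)) (by norm_num : (1 / 4 : ℝ) < 1)
    (contDiffOn_boostCLM_apply _) hwsmooth hwb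
  -- instantiate the shadow at the witness
  have hQS := H 1 (fun _ ↦ 1) (fun _ ↦ 0) (fun _ ↦ 1) (fun _ ↦ Λ) (fun _ _ ↦ 0) 2 (1 / 2)
    ⟨fun _ ↦ ⟨by unfold Kerr.IsSubextremal; norm_num, by simp [Kerr.rMinus],
      by rw [Kerr.rPlus_zero_right zero_le_one]; norm_num⟩,
     fun _ t ↦ hγ t,
     fun _ ↦ ⟨contDiff_const, hΛsmooth⟩,
     fun i j hij ↦ absurd (Subsingleton.elim i j) hij,
     ⟨by norm_num, by norm_num, fun _ ↦ (eventually_ge_atTop 0).mono fun t ht ↦ by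
        simp only [norm_zero]; positivity⟩⟩
    Nat.one_pos
    (fun _ ↦ ⟨?_, ?_, fun h ↦ absurd rfl h⟩)
    (fun _ ↦ ?_)
  rotate_left
  · -- slaving of the 4-velocity: orders 1, 2, 3
    intro m hm1 hm3
    change Tendsto (fun t ↦ iteratedDeriv m
      (fun s ↦ Lorentz.boostCLM (w s) (E4.basisVector 0)) t) atTop (𝓝 0)
    exact tendsto_iteratedDeriv_comp (F := fun v ↦ Lorentz.boostCLM v (E4.basisVector 0))
      (by norm_num : (1 / 4 : ℝ) < 1) (contDiffOn_boostCLM_apply _) hwsmooth hwb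
      (fun i _ hi3 ↦ hwlim i hi3) hm1 hm3
  · -- translational slaving: the expression is `-w`
    intro m hm
    have hfun : (fun s ↦ deriv (fun _ : ℝ ↦ (0 : E3)) s -
        ((((Λ s : E4 ≃L[ℝ] E4) (E4.basisVector 0)) 0)⁻¹ •
          E4.spatial ((Λ s : E4 ≃L[ℝ] E4) (E4.basisVector 0)))) = fun s ↦ -(w s) := by
      funext s
      change deriv (fun _ : ℝ ↦ (0 : E3)) s -
        ((((Lorentz.boost (w s) (hw1 s) : E4 ≃L[ℝ] E4) (E4.basisVector 0)) 0)⁻¹ •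
          E4.spatial ((Lorentz.boost (w s) (hw1 s) : E4 ≃L[ℝ] E4) (E4.basisVector 0))) = -(w s)
      rw [Lorentz.spatial_boost_apply_basisVector_zero, Lorentz.boost_apply_basisVector_zero_zero,
        inv_smul_smul₀ (Lorentz.gamma_pos (hw1 s)).ne', deriv_const, zero_sub]
    change Tendsto (fun t ↦ iteratedDeriv m (fun s ↦ deriv (fun _ : ℝ ↦ (0 : E3)) s -
        ((((Λ s : E4 ≃L[ℝ] E4) (E4.basisVector 0)) 0)⁻¹ •
          E4.spatial ((Λ s : E4 ≃L[ℝ] E4) (E4.basisVector 0)))) t) atTop (𝓝 0)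
    rw [hfun]
    simp only [iteratedDeriv_fun_neg]
    simpa using (hwlim m (hm.trans (by norm_num))).neg
  · -- the weighted jet rates of orders 2 and 3
    intro m hm2 hm3
    change Tendsto (fun t : ℝ ↦ t ^ (3 / 4 : ℝ) * ‖iteratedDeriv m
      (fun s ↦ Lorentz.boostCLM (w s) (E4.basisVector 0)) t‖) atTop (𝓝 0)
    have hm3' : m ≤ 3 := hm3
    -- eventual bound `t^{3/4}‖…‖ ≤ m!·C·Kᵐ·(1+t²)^{3/8 - 7m/24}`
    have hev : ∀ᶠ t in atTop, ‖t ^ (3 / 4 : ℝ) * ‖iteratedDeriv m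
        (fun s ↦ Lorentz.boostCLM (w s) (E4.basisVector 0)) t‖‖ ≤
        (m.factorial * C * K ^ m) * (1 + t ^ 2) ^ ((3 / 8 : ℝ) + (-(7 / 24) : ℝ) * m) := by
      filter_upwards [hdom, eventually_ge_atTop (0 : ℝ)] with t ht ht0
      have hf0 : (0 : ℝ) < 1 + t ^ 2 := by positivity
      have hb := hC t (K * (1 + t ^ 2) ^ (-(7 / 24) : ℝ)) m hm3' (fun i hi1 him ↦ ht i hi1 (him.trans hm3'))
      rw [Real.norm_eq_abs, abs_of_nonneg (mul_nonneg (Real.rpow_nonneg ht0 _) (norm_nonneg _))]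
      calc t ^ (3 / 4 : ℝ) * ‖iteratedDeriv m (fun s ↦ Lorentz.boostCLM (w s) (E4.basisVector 0)) t‖
          ≤ (1 + t ^ 2) ^ (3 / 8 : ℝ) * (m.factorial * C * (K * (1 + t ^ 2) ^ (-(7 / 24) : ℝ)) ^ m) :=
            mul_le_mul (rpow_three_quarters_le ht0) hb (norm_nonneg _) (Real.rpow_nonneg hf0.le _)
        _ = (m.factorial * C * K ^ m) * (1 + t ^ 2) ^ ((3 / 8 : ℝ) + (-(7 / 24) : ℝ) * m) := by
            rw [mul_pow, ← Real.rpow_mul_natCast hf0.le, Real.rpow_add hf0]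
            ring
    refine squeeze_zero_norm' hev ?_
    have hexp : (3 / 8 : ℝ) + (-(7 / 24) : ℝ) * m < 0 := by
      have : (2 : ℝ) ≤ m := by exact_mod_cast hm2
      nlinarith
    simpa using (tendsto_rpow_one_add_sq hexp).const_mul (m.factorial * C * K ^ m)
  -- QS forces the weighted 4-velocity rate …
  have hrate := weightedRate_e0_of_QS_one (γ := 2) (κ := 1 / 2) (V := 0) (fun _ ↦ 1) (fun _ ↦ 0)
    (fun _ ↦ Λ) (fun _ _ ↦ 0) rfl one_ne_zero (hΛsmooth.of_le (by exact_mod_cast le_top))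
    contDiff_const hγ ⟨by norm_num, by norm_num⟩
    ((eventually_ge_atTop 0).mono fun t ht ↦ by simp only [norm_zero]; positivity)
    (Eventually.of_forall fun t ↦ by simp) hQS
  -- … which fails along the sampling times `tₙ = √((2πn)⁴ − 1)`
  have hev : ∀ᶠ t in atTop, t ^ (3 / 4 : ℝ) *
      ‖deriv (fun s ↦ ((Λ s : E4 ≃L[ℝ] E4) (E4.basisVector 0))) t‖ < 1 / 16 :=
    (tendsto_order.1 hrate).2 _ (by norm_num)
  obtain ⟨T, hT⟩ := (hev.and (eventually_ge_atTop 1)).exists_forall_of_atTop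
  obtain ⟨n, hn⟩ := exists_nat_gt (max T 1)
  have hn1 : 1 ≤ n := by
    have h : (1 : ℝ) < n := (le_max_right _ _).trans_lt hn
    exact_mod_cast h.le
  obtain ⟨sf, sψ, ssin, scos, sge⟩ := samplingTime_spec hn1
  set tn : ℝ := Real.sqrt ((n * (2 * Real.pi)) ^ 4 - 1) with htn
  have htnT : T ≤ tn := ((le_max_left _ _).trans hn.le).trans sge
  obtain ⟨hlt, htn1⟩ := hT tn htnT
  have hψtn : ψ0 tn = n * (2 * Real.pi) := by
    rw [hψ0def]; dsimp only; rw [sf, sψ]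
  have hsin : Real.sin (ψ0 tn) = 0 := by rw [hψtn, ssin]
  have hcos : Real.cos (ψ0 tn) = 1 := by rw [hψtn, scos]
  have hu0 : u tn = 0 := by rw [hudef]; simp [hsin]
  have hu' : HasDerivAt u (ε * (A0 tn * ψ1 tn)) tn := by
    have h := (hasDerivAt_prod0 hA hS0 tn).const_mul ε
    rw [hsin, hcos, mul_zero, zero_add, one_mul] at h
    exact h
  have hV : HasDerivAt (fun s ↦ Lorentz.gamma (w s) • w s) ((ε * (A0 tn * ψ1 tn)) • e) tn :=
    hasDerivAt_gamma_smul_of_zero he hu' hu0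
  have htn0 : 0 < tn := one_pos.trans_le htn1
  have hprod_pos : 0 < A0 tn * ψ1 tn := by
    refine mul_pos (hApos tn) ?_
    rw [hψ1def]; dsimp only
    have : (0 : ℝ) < (1 + tn ^ 2) ^ ((1 / 4 : ℝ) - 1) := Real.rpow_pos_of_pos (by positivity) _
    positivity
  have hlow : ε * (A0 tn * ψ1 tn) ≤ ‖deriv (fun s ↦ ((Λ s : E4 ≃L[ℝ] E4) (E4.basisVector 0))) tn‖ := by
    have h1 := norm_deriv_gamma_smul_le hwsmooth hw1 tn
    rw [hV.deriv, norm_smul, he, mul_one, Real.norm_eq_abs,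
      abs_of_pos (mul_pos (by norm_num) hprod_pos)] at h1
    exact h1
  have hge : 1 / 16 ≤ tn ^ (3 / 4 : ℝ) * (ε * (A0 tn * ψ1 tn)) := by
    have h : 1 / 4 ≤ tn ^ (3 / 4 : ℝ) * (A0 tn * ψ1 tn) := by
      have h0 := weighted_ampl2_ge htn1
      simp only [hA0def, hψ1def]
      exact h0
    rw [hε]
    have : tn ^ (3 / 4 : ℝ) * (1 / 4 * (A0 tn * ψ1 tn)) = 1 / 4 * (tn ^ (3 / 4 : ℝ) * (A0 tn * ψ1 tn)) := by
      ring
    rw [this]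
    linarith
  have : 1 / 16 ≤ tn ^ (3 / 4 : ℝ) *
      ‖deriv (fun s ↦ ((Λ s : E4 ≃L[ℝ] E4) (E4.basisVector 0))) tn‖ :=
    hge.trans (mul_le_mul_of_nonneg_left hlow (Real.rpow_nonneg (by positivity) _))
  linarith

end Summit.FinalStateConjecture.FinalStateConjecture.Theorems.WeightedQuasiStationarity.Negative

end
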